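import Summits.BirchSwinnertonDyer.BirchSwinnertonDyer.Theorems.ByReductionTypeAtTwoEulerCharAssembly
import Summits.BirchSwinnertonDyer.BirchSwinnertonDyer.Theorems.ByReductionTypeAtTwoGoodOrdTowerControlLayerBoundP
import Summits.BirchSwinnertonDyer.BirchSwinnertonDyer.Theorems.ByReductionTypeAtTwoGoodOrdTowerControlAllP
import HarnessLib

/-!
# Route `ByReductionTypeAtTwo` (K4), TOWER road — Lemma 3.4 at layer `0`: the formal-group coinvariant count is AT MOST
# `#Ẽ(𝔽_p)`, hence `#𝒦_{v,0}[p^∞] = #(Ê(𝔪_∞)/(g−1))[p^∞] · p^{ord_p #Ẽ(𝔽_p)} ≤ #Ẽ(𝔽_p) · p^{ord_p #Ẽ(𝔽_p)}`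

Cell `bsd-2adic`, seat `bsd-2adic-tower-1` (GEN 25), `--supports stmt-BirchSwinnertonDyer-19271` (helper). TOOL theorems only
(no definition, no named fact, no `sorry`); closes nothing by itself; BSD is not proved by any of this. Part (e₂) of the
programme «Greenberg LNM 1716 Lemma 3.4 at layer `0` EXACT ⇒ Thm. 4.1 over `ℚ` ⇒ the `hEC` binder of the TOWER doors in the
kernel» (siblings `…EulerCharLayerZero/CoinvExact/CoinvInput/Devissage/ReductionCount/Assembly.lean`).

* §1 `finite_primary_formalCoinv_and_natCard_le` — `#(M₁/(g−1)M₁)[p^∞] ≤ #Ẽ(𝔽_p)` (GEN 20 brick F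
  `natCard_torsionBy_coinv_formal_le_of_localEP` — Kummer, Tate's formula `localEP_rat`, local duality, Lutz — run with the
  EXACT set of Frobenius-fixed reductions `SF = red₀(E(K̄_v)^{H_∞})` of `…EulerCharReductionCount`);
* §2 the PRODUCT formula `#𝒦_{v,0}[p^∞] = #(M₁/(g−1)M₁)[p^∞] · p^{ord_p #Ẽ(𝔽_p)}` and the bound `≤ #Ẽ(𝔽_p) · p^{ord_p #Ẽ(𝔽_p)}`;
  §3–§4 the `p = 2` reading and the curve-level statements. LEFT of Lemma 3.4 at layer `0`: the LOWER bound
  `p^{ord_p #Ẽ(𝔽_p)} ≤ #(M₁/(g−1)M₁)[p^∞]` (`#H¹(ℚ_p, Ê(𝔪̄)) = #Ẽ(𝔽_p)_p`: Coates–Greenberg, Tate duality, Weil pairing).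

References: [GreenbergLNM1716] §3 Lemma 3.4 (p. 89), §2 pp. 70–75; [MilneADT2006] I Thm. 2.8, Cor. 2.3.
-/

set_option autoImplicit false
-- the Theorems namespace of this sub repeats the summit name by design (D-0017 nested layout: Summit.<S>.<Sub>)
set_option linter.dupNamespace false

noncomputable section

open scoped Classical NNReal ValuativeRel

universe u

namespace Summit.BirchSwinnertonDyer.BirchSwinnertonDyer.Theorems.GoodOrdTower

open NumberField IsDedekindDomain Field Literature.NumberTheory.EllipticCurves
  Literature.NumberTheory.GaloisRepresentations IsDedekindDomain.HeightOneSpectrum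
  Literature.NumberTheory.EllipticCurves.FormalGroupChart Literature.NumberTheory.EllipticCurves.ResKernel
  Literature.NumberTheory.EllipticCurves.Rank1Residual WeierstrassCurve Rat.HeightOneSpectrum

variable {p : ℕ} [hp : Fact p.Prime] {κ : ZpExtension ℚ p}

/-! ## §1 The formal-group coinvariant count is at most `#Ẽ(𝔽_p)` -/
set_option maxHeartbeats 3200000 in
/-- **`#(M₁/(g−1)M₁)[p^∞] ≤ #Ẽ(𝔽_p)`** at the package level of `…EulerCharAssembly` (`W/ℚ` globally minimal and elliptic,
`GoodOrd W p`, `κ` cyclotomic, `v ∋ p`, `w` spectral, `red₀` the reduction of `W_ℤ ⊗ 𝒪_w`, `g ∈ H_0` generating `H_0` with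
`H_∞`, `M₁ = E(K̄_v)^{H_∞} ∩ ker red₀`, `D₁ = g − 1`): the `p`-power torsion of `M₁/D₁M₁` is finite of order at most
`reductionPointCount W p`. GEN 20's brick F `natCard_torsionBy_coinv_formal_le_of_localEP` at layer `0` with Tate's formula
`localEP_rat` and `SF = red₀(E(K̄_v)^{H_∞})` (`finite_range_localRed_fixedPoints_and_natCard_eq`; `hSF` by the Hensel lift
`exists_fixed_localRed_eq`), summed over the depths by `finite_and_natCard_le_of_forall_torsionBy_le`.
[cite: GreenbergLNM1716, §3 Lemma 3.4 (p. 89)] [cite: MilneADT2006, I Thm. 2.8, Cor. 2.3, Lemma 3.3] -/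
theorem finite_primary_formalCoinv_and_natCard_le (hκ : κ.IsCyclotomic) (v : HeightOneSpectrum (𝓞 ℚ))
    (hpv : ((p : ℕ) : 𝓞 ℚ) ∈ v.asIdeal) (W : WeierstrassCurve ℚ) [W.IsGloballyMinimal] [W.IsElliptic] (hgo : GoodOrd W p)
    {w : Valuation (AlgebraicClosure (v.adicCompletion ℚ)) ℝ≥0}
    (hw : ∀ x, (w x : ℝ) = spectralNorm (v.adicCompletion ℚ) (AlgebraicClosure (v.adicCompletion ℚ)) x)
    (red₀ : localPoints W (v.adicCompletion ℚ) →+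
      (((integralModelInt W).map (algebraMap ℤ ↥w.valuationSubring)).map
        (IsLocalRing.residue ↥w.valuationSubring)).toAffine.Point)
    (hred₀ : ∀ P : localPoints W (v.adicCompletion ℚ), red₀ P =
      ((integralModelInt W).map (algebraMap ℤ ↥w.valuationSubring)).reducePoint
        (Affine.Point.congrEquiv (localIntModel_baseChange W w.valuationSubring).symm P))
    {g : absoluteGaloisGroup (v.adicCompletion ℚ)}
    (hg0 : g ∈ localSubgroup (κ.layerSubgroup 0) (v.adicCompletion ℚ))
    (hgen : ∀ U : Subgroup (absoluteGaloisGroup (v.adicCompletion ℚ)),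
      IsOpen (U : Set (absoluteGaloisGroup (v.adicCompletion ℚ))) →
        localSubgroup κ.kerSubgroup (v.adicCompletion ℚ) ≤ U → g ∈ U →
          localSubgroup (κ.layerSubgroup 0) (v.adicCompletion ℚ) ≤ U)
    (M₁ : AddSubgroup (localPoints W (v.adicCompletion ℚ)))
    (hM₁ : ∀ a, a ∈ M₁ ↔ a ∈ red₀.ker ∧ ∀ h ∈ localSubgroup κ.kerSubgroup (v.adicCompletion ℚ), h • a = a)
    (D₁ : M₁ →+ M₁) (hD₁ : ∀ a : M₁, ((D₁ a : M₁) : localPoints W (v.adicCompletion ℚ)) = g • (a : _) - a) :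
    Finite (AddCommGroup.primaryComponent (M₁ ⧸ D₁.range) p) ∧
      Nat.card (AddCommGroup.primaryComponent (M₁ ⧸ D₁.range) p) ≤ W.reductionPointCount p := by
  have hord : W.HasGoodReductionAtPrime p ∧ ¬ ((p : ℕ) : ℤ) ∣ W.frobeniusTrace p := hgo
  have hΔ : ¬ ((p : ℕ) : ℤ) ∣ minimalDiscriminantInt W :=
    W.not_dvd_minimalDiscriminantInt_of_hasGoodReductionAtPrime' p hord.1
  have hap := hord.2
  -- the spectral valuation, the model, the reduction map (as in `SelmerCorankControlRatOrdinaryProofs` §1)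
  have hvO : w.Integers w.valuationSubring := Valuation.valuationSubring.integers w
  have hΔu := W.isUnit_Δ_localIntModel hpv hw hΔ
  have hpO : w ((p : ℕ) : AlgebraicClosure (v.adicCompletion ℚ)) < 1 := by
    have h := spectralValuation_algebraMap_ringOfIntegers_lt_one (v := v) hw hpv
    rwa [map_natCast] at h
  haveI hchar : CharP (IsLocalRing.ResidueField ↥w.valuationSubring) p := by
    refine (CharP.charP_iff_prime_eq_zero hp.out).mpr ?_
    rw [← map_natCast (IsLocalRing.residue ↥w.valuationSubring), IsLocalRing.residue_eq_zero_iff,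
      IsLocalRing.mem_maximalIdeal, mem_nonunits_iff, hvO.isUnit_iff_valuation_eq_one, map_natCast]
    exact ne_of_lt hpO
  haveI hV : (W.baseChange (AlgebraicClosure (v.adicCompletion ℚ))).IsIntegral w.integer :=
    ⟨⟨(integralModelInt W).map (algebraMap ℤ ↥w.integer), W.baseChange_eq_localIntModel_integer_baseChange⟩⟩
  -- the Frobenius inside `H_∞`
  obtain ⟨𝔐, h𝔐⟩ := v.localPrimesAbove_nonempty
  have hϖ : Irreducible ((p : ℕ) : v.adicCompletionIntegers ℚ) := irreducible_natCast_adicCompletionIntegers_rat hpv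
  obtain ⟨τ, hτ, hτfix⟩ := exists_isArithFrobAt_forall_smul_eq hw h𝔐 hpv hϖ
  have hτHi : τ ∈ localSubgroup κ.kerSubgroup (v.adicCompletion ℚ) :=
    (mem_localSubgroup_iff _ _ τ).mpr (resGal_mem_kerSubgroup_of_forall_smul_rootOfUnity_eq hκ hτfix)
  -- the ordinary filtration, divisibility, the Frobenius-fixed reductions
  have hordA := W.exists_zsmul_eq_zero_localRed_ne_zero hw hΔu red₀ hred₀ hpv hΔ hap
  obtain ⟨hgenr, hsurj, hdiv₁⟩ := W.localRed_ordinary_filtration hΔu red₀ hred₀ hordA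
  have hstab : ∀ (σ : absoluteGaloisGroup (v.adicCompletion ℚ)) (Q : localPoints W (v.adicCompletion ℚ)),
      red₀ Q = 0 → red₀ (σ • Q) = 0 :=
    fun σ Q hQ ↦ (W.localRed_smul_eq_zero_iff hw hΔu red₀ hred₀ σ Q).mpr hQ
  have hkst : ∀ (σ : absoluteGaloisGroup (v.adicCompletion ℚ)) (a : (localPoints W (v.adicCompletion ℚ))), a ∈ red₀.ker → σ • a ∈ red₀.ker :=
    fun σ a ha ↦ (AddMonoidHom.mem_ker).mpr (hstab σ a ((AddMonoidHom.mem_ker).mp ha))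
  have hker : ∀ Q : localPoints W (v.adicCompletion ℚ), red₀ Q = 0 ↔
      (Q : (W.baseChange (AlgebraicClosure (v.adicCompletion ℚ))).toAffine.Point) ∈
        kernel w (W.baseChange (AlgebraicClosure (v.adicCompletion ℚ))) := fun Q ↦
    W.localRed_eq_zero_iff_mem_kernel hΔu red₀ hred₀ Q
  haveI hHiN : (localSubgroup κ.kerSubgroup (v.adicCompletion ℚ)).Normal := by
    rw [localSubgroup_eq_comap]; exact Subgroup.Normal.comap inferInstance _
  -- integrality over the layer field (for Lutz at the layer)
  haveI := MultTowerNS2.finiteDimensional_fixedField_localSubgroup_layerSubgroup (κ := κ) v 0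
  haveI hVL : (W.baseChange (IntermediateField.fixedField (localSubgroup (κ.layerSubgroup 0) (v.adicCompletion ℚ)) : IntermediateField (v.adicCompletion ℚ) (AlgebraicClosure (v.adicCompletion ℚ)))).IsIntegral
      (w.comap (algebraMap (IntermediateField.fixedField (localSubgroup (κ.layerSubgroup 0) (v.adicCompletion ℚ)) : IntermediateField (v.adicCompletion ℚ) (AlgebraicClosure (v.adicCompletion ℚ))) (AlgebraicClosure (v.adicCompletion ℚ)))).integer := by
    refine ⟨⟨(integralModelInt W).map (algebraMap ℤ _), ?_⟩⟩
    conv_lhs => rw [← map_integralModelInt W]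
    rw [baseChange, baseChange, WeierstrassCurve.map_map, WeierstrassCurve.map_map]
    congr 1
    exact RingHom.ext_int _ _
  -- the EXACT finite set of Frobenius-fixed reductions: `SF = red₀(E(K̄_v)^{H_∞})`, `#SF = #Ẽ(𝔽_p)`
  obtain ⟨hfinR, hR⟩ := finite_range_localRed_fixedPoints_and_natCard_eq (κ := κ) W hw hΔu red₀ hred₀ hpv hΔ h𝔐 hτ hτHi
  haveI := hfinR
  let Rset : Set ((((integralModelInt W).map (algebraMap ℤ ↥w.valuationSubring)).map
      (IsLocalRing.residue ↥w.valuationSubring)).toAffine.Point) :=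
    (red₀.comp (FixedPoints.addSubgroup (localSubgroup κ.kerSubgroup (v.adicCompletion ℚ))
      (localPoints W (v.adicCompletion ℚ))).subtype).range
  have hRfin : Rset.Finite := Set.toFinite _
  let SF := hRfin.toFinset
  have hSFcard : SF.card = W.reductionPointCount p := by
    rw [← hR]
    change hRfin.toFinset.card = _
    rw [← Set.ncard_eq_toFinset_card Rset hRfin, ← Nat.card_coe_set_eq]
    rfl
  have hSF : ∀ Q : localPoints W (v.adicCompletion ℚ), red₀ (τ • Q) = red₀ Q → red₀ Q ∈ SF := by
    intro Q hQ
    obtain ⟨P₀, hP₀fix, hP₀⟩ := exists_fixed_localRed_eq W hw hΔu red₀ hred₀ hpv hΔ h𝔐 hτ Q hQ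
    rw [Set.Finite.mem_toFinset]
    exact ⟨⟨P₀, (FixedPoints.mem_addSubgroup _ _ _).mpr fun σ ↦ hP₀fix σ⟩, hP₀⟩
  -- brick F at every depth `p^k`
  have hk : ∀ k : ℕ, Finite {c : M₁ ⧸ D₁.range // p ^ k • c = 0} ∧
      Nat.card {c : M₁ ⧸ D₁.range // p ^ k • c = 0} ≤ W.reductionPointCount p := by
    intro k
    obtain ⟨hfinT, hT⟩ := natCard_torsionBy_coinv_formal_le_of_localEP hκ v hpv (localEP_rat p v hpv) W 0 k hw red₀ hker
      hstab hdiv₁ hgenr hsurj hτHi hτfix SF hSF hg0 hgen M₁ hM₁ D₁ hD₁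
    exact ⟨hfinT, hT.trans hSFcard.le⟩
  -- from the depths to the `p`-primary component
  let Qp := AddCommGroup.primaryComponent (M₁ ⧸ D₁.range) p
  have hprim : ∀ a : Qp, ∃ k : ℕ, p ^ k • a = 0 := fun a ↦ by
    obtain ⟨k, hk⟩ := (AddCommGroup.mem_primaryComponent).mp a.2
    exact ⟨k, Subtype.ext (by rw [AddSubmonoidClass.coe_nsmul, hk, ZeroMemClass.coe_zero])⟩
  have e : ∀ k : ℕ, {a : Qp // p ^ k • a = 0} ≃ {c : M₁ ⧸ D₁.range // p ^ k • c = 0} := fun k ↦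
    { toFun := fun a ↦ ⟨(a.1 : M₁ ⧸ D₁.range), by
        have h := congrArg (fun z : Qp ↦ (z : M₁ ⧸ D₁.range)) a.2
        simpa only [AddSubmonoidClass.coe_nsmul, ZeroMemClass.coe_zero] using h⟩
      invFun := fun c ↦ ⟨⟨c.1, (AddCommGroup.mem_primaryComponent).mpr ⟨k, c.2⟩⟩,
        Subtype.ext (by rw [AddSubmonoidClass.coe_nsmul, ZeroMemClass.coe_zero]; exact c.2)⟩
      left_inv := fun a ↦ Subtype.ext (Subtype.ext rfl)
      right_inv := fun c ↦ Subtype.ext rfl }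
  exact finite_and_natCard_le_of_forall_torsionBy_le p hprim
    (fun k ↦ by haveI := (hk k).1; exact Finite.of_equiv _ (e k).symm)
    (fun k ↦ by rw [Nat.card_congr (e k)]; exact (hk k).2)

/-! ## §2 The product formula and the bound -/
set_option maxHeartbeats 3200000 in
/-- **`#𝒦_{v,0}[p^∞] = #(M₁/(g−1)M₁)[p^∞] · p^{ord_p #Ẽ(𝔽_p)}`** at the package level of `…EulerCharAssembly` (inertial
generator `g`): Lemma 3.4 at layer `0` up to the formal-group coinvariant count, with NO hypothesis on that count (its
finiteness is §1). (a) `natCard_localTowerKerPrimary_eq_coinv_atP`, (b) `natCard_primary_coinv_eq_mul` with `coinvInput_ker_atP`,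
(d) `finite_range_localRed_fixedPoints_and_natCard_eq`. [cite: GreenbergLNM1716, §3 Lemma 3.4 (p. 89)] -/
theorem natCard_localTowerKerPrimary_zero_eq_mul (hκ : κ.IsCyclotomic) (v : HeightOneSpectrum (𝓞 ℚ))
    (hpv : ((p : ℕ) : 𝓞 ℚ) ∈ v.asIdeal) (W : WeierstrassCurve ℚ) [W.IsGloballyMinimal] [W.IsElliptic] (hgo : GoodOrd W p)
    {w : Valuation (AlgebraicClosure (v.adicCompletion ℚ)) ℝ≥0}
    (hw : ∀ x, (w x : ℝ) = spectralNorm (v.adicCompletion ℚ) (AlgebraicClosure (v.adicCompletion ℚ)) x)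
    (red₀ : localPoints W (v.adicCompletion ℚ) →+
      (((integralModelInt W).map (algebraMap ℤ ↥w.valuationSubring)).map
        (IsLocalRing.residue ↥w.valuationSubring)).toAffine.Point)
    (hred₀ : ∀ P : localPoints W (v.adicCompletion ℚ), red₀ P =
      ((integralModelInt W).map (algebraMap ℤ ↥w.valuationSubring)).reducePoint
        (Affine.Point.congrEquiv (localIntModel_baseChange W w.valuationSubring).symm P))
    {g : absoluteGaloisGroup (v.adicCompletion ℚ)} (hgI : g ∈ absInertia (v.adicCompletion ℚ))
    (hgen : ∀ U : Subgroup (absoluteGaloisGroup (v.adicCompletion ℚ)),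
      IsOpen (U : Set (absoluteGaloisGroup (v.adicCompletion ℚ))) →
        localSubgroup κ.kerSubgroup (v.adicCompletion ℚ) ≤ U → g ∈ U →
          localSubgroup (κ.layerSubgroup 0) (v.adicCompletion ℚ) ≤ U)
    (M₁ : AddSubgroup (localPoints W (v.adicCompletion ℚ)))
    (hM₁ : ∀ a, a ∈ M₁ ↔ a ∈ red₀.ker ∧ ∀ h ∈ localSubgroup κ.kerSubgroup (v.adicCompletion ℚ), h • a = a)
    (D₁ : M₁ →+ M₁) (hD₁ : ∀ a : M₁, ((D₁ a : M₁) : localPoints W (v.adicCompletion ℚ)) = g • (a : _) - a) :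
    Nat.card (W.localTowerKerPrimary κ (v.adicCompletion ℚ) 0) =
      Nat.card (AddCommGroup.primaryComponent (M₁ ⧸ D₁.range) p) * p ^ padicValNat p (W.reductionPointCount p) := by
  -- notation
  let K := v.adicCompletion ℚ
  let Pt : Type := localPoints W K
  let Hi : Subgroup (absoluteGaloisGroup K) := localSubgroup κ.kerSubgroup K
  let M : AddSubgroup Pt := FixedPoints.addSubgroup Hi Pt
  have hg0 : g ∈ localSubgroup (κ.layerSubgroup 0) K := by
    rw [mem_localSubgroup_iff, ZpExtension.layerSubgroup_zero]; exact Subgroup.mem_top _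
  haveI := (finite_primary_formalCoinv_and_natCard_le hκ v hpv W hgo hw red₀ hred₀ hg0 hgen M₁ hM₁ D₁ hD₁).1
  have hord : W.HasGoodReductionAtPrime p ∧ ¬ ((p : ℕ) : ℤ) ∣ W.frobeniusTrace p := hgo
  have hΔ : ¬ ((p : ℕ) : ℤ) ∣ minimalDiscriminantInt W :=
    W.not_dvd_minimalDiscriminantInt_of_hasGoodReductionAtPrime' p hord.1
  have hvO : w.Integers w.valuationSubring := Valuation.valuationSubring.integers w
  have hΔu := W.isUnit_Δ_localIntModel hpv hw hΔ
  haveI hV : (W.baseChange (AlgebraicClosure K)).IsIntegral w.integer :=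
    ⟨⟨(integralModelInt W).map (algebraMap ℤ ↥w.integer), W.baseChange_eq_localIntModel_integer_baseChange⟩⟩
  obtain ⟨𝔐, h𝔐⟩ := v.localPrimesAbove_nonempty
  have hϖ : Irreducible ((p : ℕ) : v.adicCompletionIntegers ℚ) := irreducible_natCast_adicCompletionIntegers_rat hpv
  obtain ⟨τ, hτ, hτfix⟩ := exists_isArithFrobAt_forall_smul_eq hw h𝔐 hpv hϖ
  have hτHi : τ ∈ Hi :=
    (mem_localSubgroup_iff _ _ τ).mpr (resGal_mem_kerSubgroup_of_forall_smul_rootOfUnity_eq hκ hτfix)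
  have hgred : ∀ Q : Pt, red₀ (g • Q) = red₀ Q := fun Q ↦
    localRed_smul_eq_of_mem_absInertia W hw red₀ hred₀ hpv h𝔐 hgI Q
  have hlift : ∀ x : M, ∃ x₀ : M, subOne Hi Pt g x₀ = 0 ∧ red₀ (x₀ : Pt) = red₀ (x : Pt) := fun x ↦ by
    have hτx : τ • (x : Pt) = x := (FixedPoints.mem_addSubgroup _ _ _).mp x.2 ⟨τ, hτHi⟩
    obtain ⟨P₀, hP₀fix, hP₀⟩ := exists_fixed_localRed_eq W hw hΔu red₀ hred₀ hpv hΔ h𝔐 hτ (x : Pt) (by rw [hτx])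
    refine ⟨⟨P₀, (FixedPoints.mem_addSubgroup _ _ _).mpr fun σ ↦ hP₀fix σ⟩, Subtype.ext ?_, hP₀⟩
    rw [coe_subOne_apply, hP₀fix, sub_self]; rfl
  obtain ⟨hfinR, hR⟩ := finite_range_localRed_fixedPoints_and_natCard_eq (κ := κ) W hw hΔu red₀ hred₀ hpv hΔ h𝔐 hτ hτHi
  haveI := hfinR
  obtain ⟨δ, hδ⟩ := Greenberg1999.exists_apply_resGal_ne_one_of_isCyclotomic hκ v
  have hE : ∃ δ : absoluteGaloisGroup K, resGal (K := ℚ) K δ ∉ κ.kerSubgroup :=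
    ⟨δ, fun h ↦ hδ (ZpExtension.mem_kerSubgroup.mp h)⟩
  obtain ⟨κE, hker, hγ⟩ := exists_zpExtension_kerSubgroup_eq_isTopGenerator κ K hE hgen
  have hdiv := coinvInput_ker_atP W hgo κ hκ v hpv hw red₀ hred₀ ⟨κE, hker, hγ⟩
  obtain ⟨hfinQ, hQ⟩ := natCard_primary_coinv_eq_mul W κ K red₀ hgred hlift M₁ hM₁ D₁ hD₁ hdiv
  haveI := hfinQ
  have hA := natCard_localTowerKerPrimary_eq_coinv_atP hκ v hpv W 0 hg0 hgen
  have hRp : Nat.card (AddCommGroup.primaryComponent (red₀.comp M.subtype).range p) =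
      p ^ padicValNat p (W.reductionPointCount p) := by
    rw [card_addPrimaryComponent_eq_pow, Nat.factorization_def _ hp.out, hR]
  rw [hA, hQ, hRp]

/-- **Lemma 3.4 at layer `0`, the UPPER half with explicit constant**: `#𝒦_{v,0}[p^∞] ≤ #Ẽ(𝔽_p) · p^{ord_p #Ẽ(𝔽_p)}` (package
level; §1 in the product formula). [cite: GreenbergLNM1716, §3 Lemma 3.4 (p. 89)] -/
theorem natCard_localTowerKerPrimary_zero_le_mul (hκ : κ.IsCyclotomic) (v : HeightOneSpectrum (𝓞 ℚ))
    (hpv : ((p : ℕ) : 𝓞 ℚ) ∈ v.asIdeal) (W : WeierstrassCurve ℚ) [W.IsGloballyMinimal] [W.IsElliptic] (hgo : GoodOrd W p)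
    {w : Valuation (AlgebraicClosure (v.adicCompletion ℚ)) ℝ≥0}
    (hw : ∀ x, (w x : ℝ) = spectralNorm (v.adicCompletion ℚ) (AlgebraicClosure (v.adicCompletion ℚ)) x)
    (red₀ : localPoints W (v.adicCompletion ℚ) →+
      (((integralModelInt W).map (algebraMap ℤ ↥w.valuationSubring)).map
        (IsLocalRing.residue ↥w.valuationSubring)).toAffine.Point)
    (hred₀ : ∀ P : localPoints W (v.adicCompletion ℚ), red₀ P =
      ((integralModelInt W).map (algebraMap ℤ ↥w.valuationSubring)).reducePoint
        (Affine.Point.congrEquiv (localIntModel_baseChange W w.valuationSubring).symm P))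
    {g : absoluteGaloisGroup (v.adicCompletion ℚ)} (hgI : g ∈ absInertia (v.adicCompletion ℚ))
    (hgen : ∀ U : Subgroup (absoluteGaloisGroup (v.adicCompletion ℚ)),
      IsOpen (U : Set (absoluteGaloisGroup (v.adicCompletion ℚ))) →
        localSubgroup κ.kerSubgroup (v.adicCompletion ℚ) ≤ U → g ∈ U →
          localSubgroup (κ.layerSubgroup 0) (v.adicCompletion ℚ) ≤ U)
    (M₁ : AddSubgroup (localPoints W (v.adicCompletion ℚ)))
    (hM₁ : ∀ a, a ∈ M₁ ↔ a ∈ red₀.ker ∧ ∀ h ∈ localSubgroup κ.kerSubgroup (v.adicCompletion ℚ), h • a = a)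
    (D₁ : M₁ →+ M₁) (hD₁ : ∀ a : M₁, ((D₁ a : M₁) : localPoints W (v.adicCompletion ℚ)) = g • (a : _) - a) :
    Nat.card (W.localTowerKerPrimary κ (v.adicCompletion ℚ) 0) ≤
      W.reductionPointCount p * p ^ padicValNat p (W.reductionPointCount p) := by
  have hg0 : g ∈ localSubgroup (κ.layerSubgroup 0) (v.adicCompletion ℚ) := by
    rw [mem_localSubgroup_iff, ZpExtension.layerSubgroup_zero]; exact Subgroup.mem_top _
  rw [natCard_localTowerKerPrimary_zero_eq_mul hκ v hpv W hgo hw red₀ hred₀ hgI hgen M₁ hM₁ D₁ hD₁]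
  exact Nat.mul_le_mul_right _ (finite_primary_formalCoinv_and_natCard_le hκ v hpv W hgo hw red₀ hred₀ hg0 hgen M₁ hM₁ D₁ hD₁).2

/-! ## §3 At `p = 2`: `#Ẽ(𝔽₂) = 2^{ord₂ #Ẽ(𝔽₂)}`, and the count from the lower bound alone -/
/-- **At a good ORDINARY `2`, `#Ẽ(𝔽₂) ∈ {2, 4}` is a power of `2`**: `#Ẽ(𝔽₂) ≤ 5` (the points inject into
`Option (𝔽₂ × 𝔽₂)`), `#Ẽ(𝔽₂) ≥ 1`, and `a₂ = 3 − #Ẽ(𝔽₂)` is odd. [cite: SilvermanAEC2009, V §1] -/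
theorem reductionPointCount_two_eq_pow (W : WeierstrassCurve ℚ) [W.IsGloballyMinimal] (hgo : GoodOrd W 2) :
    W.reductionPointCount 2 = 2 ^ padicValNat 2 (W.reductionPointCount 2) := by
  have hord : W.HasGoodReductionAtPrime 2 ∧ ¬ ((2 : ℕ) : ℤ) ∣ W.frobeniusTrace 2 := hgo
  have hpos : 0 < W.reductionPointCount 2 := W.reductionPointCount_pos 2
  -- `#Ẽ(𝔽₂) ≤ 5`
  have hle : W.reductionPointCount 2 ≤ 5 := by
    haveI : Finite ((integralModelInt W).map (Int.castRingHom (ZMod 2))).toAffine.Point := WeierstrassCurve.finite_point _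
    have h5 : Nat.card (Option (ZMod 2 × ZMod 2)) = 5 := by
      rw [Nat.card_eq_fintype_card]; rfl
    calc W.reductionPointCount 2
        = Nat.card ((integralModelInt W).map (Int.castRingHom (ZMod 2))).toAffine.Point := rfl
      _ ≤ Nat.card (Option (ZMod 2 × ZMod 2)) :=
          Nat.card_le_card_of_injective (fun P ↦ match P with
            | .zero => (none : Option (ZMod 2 × ZMod 2))
            | .some x y _ => some (x, y)) (by
            rintro (_ | ⟨x, y, h⟩) (_ | ⟨x', y', h'⟩) hPQ
            · rfl
            · exact (Option.some_ne_none _ hPQ.symm).elim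
            · exact (Option.some_ne_none _ hPQ).elim
            · simp only [Option.some.injEq, Prod.mk.injEq] at hPQ
              obtain ⟨rfl, rfl⟩ := hPQ
              rfl)
      _ = 5 := h5
  -- `#Ẽ(𝔽₂)` is even (`a₂ = 3 − #Ẽ(𝔽₂)` is odd)
  have heven : 2 ∣ W.reductionPointCount 2 := by
    have h2 := hord.2
    simp only [frobeniusTrace] at h2
    push_cast at h2
    rcases Nat.even_or_odd (W.reductionPointCount 2) with he | ho
    · exact he.two_dvd
    · exfalso; apply h2
      obtain ⟨m, hm⟩ := ho
      exact ⟨1 - m, by rw [hm]; push_cast; ring⟩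
  generalize W.reductionPointCount 2 = N at hpos hle heven ⊢
  have h1 : padicValNat 2 2 = 1 := by simp
  have h2 : padicValNat 2 4 = 2 := by
    rw [show (4 : ℕ) = 2 ^ 2 by norm_num, padicValNat.prime_pow]
  interval_cases N
  · exact absurd heven (by norm_num)
  · rw [h1, pow_one]
  · exact absurd heven (by norm_num)
  · rw [h2]; norm_num
  · exact absurd heven (by norm_num)

set_option maxHeartbeats 3200000 in
/-- **At `p = 2`, Lemma 3.4 at layer `0` follows from the LOWER bound on the formal-group coinvariant count alone** (package
level): if `2^{ord₂ #Ẽ(𝔽₂)} ≤ #(M₁/(g−1)M₁)[2^∞]`, then `#𝒦_{v,0}[2^∞] = (2^{ord₂ #Ẽ(𝔽₂)})²` — the upper bound is §1 with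
`#Ẽ(𝔽₂) = 2^{ord₂ #Ẽ(𝔽₂)}` (`reductionPointCount_two_eq_pow`). [cite: GreenbergLNM1716, §3 Lemma 3.4 (p. 89)] -/
theorem natCard_localTowerKerPrimary_zero_eq_sq_two_of_formalCountGe {κ : ZpExtension ℚ 2} (hκ : κ.IsCyclotomic)
    (v : HeightOneSpectrum (𝓞 ℚ)) (hpv : ((2 : ℕ) : 𝓞 ℚ) ∈ v.asIdeal) (W : WeierstrassCurve ℚ) [W.IsGloballyMinimal]
    [W.IsElliptic] (hgo : GoodOrd W 2)
    {w : Valuation (AlgebraicClosure (v.adicCompletion ℚ)) ℝ≥0}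
    (hw : ∀ x, (w x : ℝ) = spectralNorm (v.adicCompletion ℚ) (AlgebraicClosure (v.adicCompletion ℚ)) x)
    (red₀ : localPoints W (v.adicCompletion ℚ) →+
      (((integralModelInt W).map (algebraMap ℤ ↥w.valuationSubring)).map
        (IsLocalRing.residue ↥w.valuationSubring)).toAffine.Point)
    (hred₀ : ∀ P : localPoints W (v.adicCompletion ℚ), red₀ P =
      ((integralModelInt W).map (algebraMap ℤ ↥w.valuationSubring)).reducePoint
        (Affine.Point.congrEquiv (localIntModel_baseChange W w.valuationSubring).symm P))
    {g : absoluteGaloisGroup (v.adicCompletion ℚ)} (hgI : g ∈ absInertia (v.adicCompletion ℚ))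
    (hgen : ∀ U : Subgroup (absoluteGaloisGroup (v.adicCompletion ℚ)),
      IsOpen (U : Set (absoluteGaloisGroup (v.adicCompletion ℚ))) →
        localSubgroup κ.kerSubgroup (v.adicCompletion ℚ) ≤ U → g ∈ U →
          localSubgroup (κ.layerSubgroup 0) (v.adicCompletion ℚ) ≤ U)
    (M₁ : AddSubgroup (localPoints W (v.adicCompletion ℚ)))
    (hM₁ : ∀ a, a ∈ M₁ ↔ a ∈ red₀.ker ∧ ∀ h ∈ localSubgroup κ.kerSubgroup (v.adicCompletion ℚ), h • a = a)
    (D₁ : M₁ →+ M₁) (hD₁ : ∀ a : M₁, ((D₁ a : M₁) : localPoints W (v.adicCompletion ℚ)) = g • (a : _) - a)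
    (hFge : 2 ^ padicValNat 2 (W.reductionPointCount 2) ≤ Nat.card (AddCommGroup.primaryComponent (M₁ ⧸ D₁.range) 2)) :
    Nat.card (W.localTowerKerPrimary κ (v.adicCompletion ℚ) 0) = (2 ^ padicValNat 2 (W.reductionPointCount 2)) ^ 2 := by
  have hg0 : g ∈ localSubgroup (κ.layerSubgroup 0) (v.adicCompletion ℚ) := by
    rw [mem_localSubgroup_iff, ZpExtension.layerSubgroup_zero]; exact Subgroup.mem_top _
  obtain ⟨hfin, hle⟩ := finite_primary_formalCoinv_and_natCard_le hκ v hpv W hgo hw red₀ hred₀ hg0 hgen M₁ hM₁ D₁ hD₁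
  haveI := hfin
  rw [reductionPointCount_two_eq_pow W hgo] at hle
  exact natCard_localTowerKerPrimary_zero_eq_sq_of_formalCount hκ v hpv W hgo hw red₀ hred₀ hgI hgen M₁ hM₁ D₁ hD₁
    (le_antisymm hle hFge)

/-! ## §4 The curve-level statements (the package constructed as in `…GoodOrdTowerControlLayerBoundP`) -/
set_option maxHeartbeats 3200000 in
/-- **Greenberg's Lemma 3.4 at layer `0`, UPPER half, for EVERY good ordinary `W/ℚ` and every prime `p`**: for `W`
globally minimal and elliptic with `GoodOrd W p`, `κ` the cyclotomic `ℤ_p`-extension and `v ∋ p`, the `p`-power torsion of the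
local tower kernel at layer `0` satisfies `#𝒦_{v,0}[p^∞] ≤ #Ẽ(𝔽_p) · p^{ord_p #Ẽ(𝔽_p)}` (Greenberg: `= #Ẽ(𝔽_p)_p²`).
[cite: GreenbergLNM1716, §3 Lemma 3.4 (p. 89)] -/
theorem natCard_localTowerKerPrimary_zero_le (hκ : κ.IsCyclotomic) (v : HeightOneSpectrum (𝓞 ℚ))
    (hpv : ((p : ℕ) : 𝓞 ℚ) ∈ v.asIdeal) (W : WeierstrassCurve ℚ) [W.IsGloballyMinimal] [W.IsElliptic] (hgo : GoodOrd W p) :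
    Nat.card (W.localTowerKerPrimary κ (v.adicCompletion ℚ) 0) ≤
      W.reductionPointCount p * p ^ padicValNat p (W.reductionPointCount p) := by
  have hord : W.HasGoodReductionAtPrime p ∧ ¬ ((p : ℕ) : ℤ) ∣ W.frobeniusTrace p := hgo
  have hΔ : ¬ ((p : ℕ) : ℤ) ∣ minimalDiscriminantInt W :=
    W.not_dvd_minimalDiscriminantInt_of_hasGoodReductionAtPrime' p hord.1
  obtain ⟨w, hw⟩ := v.exists_spectralValuation
  have hvO : w.Integers w.valuationSubring := Valuation.valuationSubring.integers w
  have hΔu := W.isUnit_Δ_localIntModel hpv hw hΔ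
  let red₀ : localPoints W (v.adicCompletion ℚ) →+
      (((integralModelInt W).map (algebraMap ℤ ↥w.valuationSubring)).map
        (IsLocalRing.residue ↥w.valuationSubring)).toAffine.Point :=
    (goodReductionHom _ hvO hΔu).comp
      (Affine.Point.congrEquiv (localIntModel_baseChange W w.valuationSubring).symm).toAddMonoidHom
  have hred₀ : ∀ P : localPoints W (v.adicCompletion ℚ), red₀ P =
      ((integralModelInt W).map (algebraMap ℤ ↥w.valuationSubring)).reducePoint
        (Affine.Point.congrEquiv (localIntModel_baseChange W w.valuationSubring).symm P) :=
    fun P ↦ rfl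
  have hstab : ∀ (σ : absoluteGaloisGroup (v.adicCompletion ℚ)) (Q : localPoints W (v.adicCompletion ℚ)),
      red₀ Q = 0 → red₀ (σ • Q) = 0 :=
    fun σ Q hQ ↦ (W.localRed_smul_eq_zero_iff hw hΔu red₀ hred₀ σ Q).mpr hQ
  have hkst : ∀ (σ : absoluteGaloisGroup (v.adicCompletion ℚ)) (a : (localPoints W (v.adicCompletion ℚ))), a ∈ red₀.ker → σ • a ∈ red₀.ker :=
    fun σ a ha ↦ (AddMonoidHom.mem_ker).mpr (hstab σ a ((AddMonoidHom.mem_ker).mp ha))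
  -- layer `0`: an inertial topological generator `g`, `M₁ = A₁^{H_∞}`, `D₁ = g − 1`
  obtain ⟨g, hgI, -, hgen⟩ := exists_inertial_generator hκ v hpv 0
  let M₁s : AddSubgroup (localPoints W (v.adicCompletion ℚ)) := red₀.ker ⊓ FixedPoints.addSubgroup (localSubgroup κ.kerSubgroup (v.adicCompletion ℚ)) (localPoints W (v.adicCompletion ℚ))
  have hM₁s : ∀ a, a ∈ M₁s ↔ a ∈ red₀.ker ∧ ∀ h ∈ (localSubgroup κ.kerSubgroup (v.adicCompletion ℚ)), h • a = a := fun a ↦ by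
    change a ∈ red₀.ker ⊓ FixedPoints.addSubgroup (localSubgroup κ.kerSubgroup (v.adicCompletion ℚ)) (localPoints W (v.adicCompletion ℚ)) ↔ _
    rw [AddSubgroup.mem_inf, FixedPoints.mem_addSubgroup]
    exact ⟨fun ⟨h1, h2⟩ ↦ ⟨h1, fun σ hσ ↦ h2 ⟨σ, hσ⟩⟩, fun ⟨h1, h2⟩ ↦ ⟨h1, fun σ ↦ h2 σ σ.2⟩⟩
  let D₁ : M₁s →+ M₁s :=
    { toFun := fun a ↦ ⟨g • (a : (localPoints W (v.adicCompletion ℚ))) - a, ⟨red₀.ker.sub_mem (hkst g a a.2.1) a.2.1,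
        (subOne (localSubgroup κ.kerSubgroup (v.adicCompletion ℚ)) (localPoints W (v.adicCompletion ℚ)) g ⟨(a : (localPoints W (v.adicCompletion ℚ))), a.2.2⟩).2⟩⟩
      map_zero' := Subtype.ext (by simp)
      map_add' := fun a b ↦ Subtype.ext (by
        simp only [AddSubgroup.coe_add, smul_add]
        abel) }
  have hD₁ : ∀ a : M₁s, ((D₁ a : M₁s) : (localPoints W (v.adicCompletion ℚ))) = g • (a : (localPoints W (v.adicCompletion ℚ))) - a := fun _ ↦ rfl
  exact natCard_localTowerKerPrimary_zero_le_mul hκ v hpv W hgo hw red₀ hred₀ hgI hgen M₁s hM₁s D₁ hD₁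

/-- **At `p = 2`: `#𝒦_{v,0}[2^∞] ≤ (2^{ord₂ #Ẽ(𝔽₂)})²` for every `W/ℚ` with good ORDINARY reduction at `2`** (the sharp
upper half of Lemma 3.4 at layer `0`; `#Ẽ(𝔽₂) ∈ {2, 4}`). [cite: GreenbergLNM1716, §3 Lemma 3.4 (p. 89)] -/
theorem natCard_localTowerKerPrimary_zero_le_sq_two {κ : ZpExtension ℚ 2} (hκ : κ.IsCyclotomic)
    (v : HeightOneSpectrum (𝓞 ℚ)) (hpv : ((2 : ℕ) : 𝓞 ℚ) ∈ v.asIdeal) (W : WeierstrassCurve ℚ) [W.IsGloballyMinimal]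
    [W.IsElliptic] (hgo : GoodOrd W 2) :
    Nat.card (W.localTowerKerPrimary κ (v.adicCompletion ℚ) 0) ≤ (2 ^ padicValNat 2 (W.reductionPointCount 2)) ^ 2 := by
  have h := natCard_localTowerKerPrimary_zero_le hκ v hpv W hgo
  nth_rw 1 [reductionPointCount_two_eq_pow W hgo] at h
  rwa [sq]

end Summit.BirchSwinnertonDyer.BirchSwinnertonDyer.Theorems.GoodOrdTower

end
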